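import Summits.QuantumFields.YangMills.Theorems.BalabanUVNodesN15TwoSpacingGluingCutRows
import HarnessLib

/-!
# Route «BalabanUVNodes» (cluster K4 «SpineRates»), Track-A DAG node N15 = NE2, BACKGROUND LAYER — GLUING WITH PER-CUBE LOCALITY DEFECTS: when each cube inverts the glued operator against its
# partition function only MODULO a defect, `M_{h_□}∘Δ∘G_□ = M_{h_□} + E_□` (the dressed cube at a live background: file 23 `mulOp_comp_sub_comp_dressedV_of_defect`, the tail across the margin:
# file 22 ∕ FILE 68), the parametrix identity reads `Δ∘G₀ = 1 − R̃`, `R̃ := R − Σ_□ E_□M_{h_□}`, and dag-n15-c's resummation (FILES 43∕44∕63) runs verbatim with `R̃`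

Cell `pub-ymgap`, seat `pub-ymgap-dag-n15-w3` (WIDTH SEAT 3∕3 on node N15, director-ym №197 ∕ HUMAN RULING D-0149; plan `W-SEAT-START-LIST.md` §n15 item 3 «LG-vector + background layers at
GENERAL small-field U» — thirty-second piece).  `bears_on: R4∕N15 · K3⁷ SpineGivenEndpointR13SepCoPH (stmt-QuantumFields-20544)`.  Filed `--kind proof --supports stmt-QuantumFields-20544 --as
helper` — COUNT-NEUTRAL.  Theorems only; 0 `sorry`.  Imports BY NAME dag-n15-c FILE 63 `…N15TwoSpacingGluingCutRows` (`parametrix_cut`; through it FILE 43 `glueInv`, `glueInv_comp_lap`,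
`lap_comp_glueInv`, `isUnit_neumannR`, `hasMaj_glueInv`; FILE 44 `hasMaj_idef_glueInv`; FILE 45 `parametrix`, `remainder`, `commOp`, `lap_comp_cube`, `sum_mulOp_sq`, `hasMaj_parametrix`,
`hasMaj_idef_parametrix`, `hasMaj_sum_overlap`, `hasMaj_comp_diag`, `hasMaj_diag_comp`; FILE 57 `hasMaj_remainder_in`, `hasMaj_idef_remainder_in`); lit `hasMaj_mulOp`, `hasMaj_idef_mulOp`,
`idef_comp`∕`idef_sub`; nothing in the tree is modified; nothing of dag-n15-c's is restated (their identity is the case `E ≡ 0`).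

WHY.  [Balaban1984PropagatorsII] (2.91) p. 239, `Δ_aG₀ = I − R`, rests on the EXACT per-cube locality `h_□Δ_aG(□)h_□ = h_□²` (FILE 45 `lap_comp_parametrix`'s `hloc`).  For dag-n15-a's
Neumann-by-images cube at `U ≡ 1` it is exact.  At a LIVE background it is not: the cube is dressed by a decaying perturbation of the jet, and either the nonlocal tail of `Δ_a` across the
smooth cut's margin (file 22 `mulOp_comp_comp_sandwich_of_hloc`: `M_hΔ(M_χ̃N) = M_h − M_hN_LM_{1−χ̃}N`) or the cube's own defect slot (file 23: `M_h(Δ − 𝒱)X = M_h + E(1 + 𝒱X)`) leaves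
`M_{h_□}ΔG_□ = M_{h_□} + E_□` with `E_□` exponentially small in the margin (FILE 68 `hasMaj_far_sandwich`) but NOT zero — the same phenomenon as [Balaban1984PropagatorsI] (1.120)–(1.123)
p. 37, where the nonlocal `P(dh)` enters `R`.  THIS FILE: ★ `lap_comp_parametrix_of_defect` — `Δ∘(Σ_□M_{h_□}G_□M_{h_□}) = 1 − (R − Σ_□E_□M_{h_□})` EXACTLY (FILE 45's algebra + the defects);
★★ `hasMaj_defectSum` ∕ `hasMaj_idef_defectSum` — `Σ_□E_□M_{h_□} ≤ N_ov·εe^{−δd}` and its η-defect `≤ N_ov(εo + r_E)e^{−δd}` from OUTPUT-localized per-cube defect rows `E_□ ≤ 1_{S_□}(y)·εe^{−δd}`,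
`𝔇(E′_□, E_□) ≤ 1_{S_□}(y)·r_Ee^{−δd}` (bounded overlap); ★★ `hasMaj_remainderD` ∕ `hasMaj_idef_remainderD` — the full `R̃`; ★★★ `glued_inverse_of_defect` (`glueInv G₀ R̃` is a two-sided
inverse of `Δ`), ★★★ `hasMaj_glued_of_cutRows_defect` ∕ ★★★ `hasMaj_idef_glued_of_cutRows_defect` — FILE 63's two glued letters VERBATIM with `θ₀ ↦ θ₀ + ε`, `r ↦ r + εo + r_E`.

HONEST FRAMING ∕ LIMITS.  Finite-dimensional resolvent algebra + block-majorant bookkeeping over DISPLAYED per-cube rows (cut letters, input-localized commutator rows, output-localized defect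
rows, partition data, overlap); [B6] (2.36)–(2.37) p.229, (2.91)–(2.92) p.239, (2.133)–(2.136) p.247; [B5] (1.120)–(1.123) p.37 = SHAPES ∕ MECHANISM; nothing of [B5]∕[B6]∕[B9] asserted.  NE2⁺
NOT PRINTED, NOT proved; N15 NOT discharged; counts of record UNMOVED (typed 28∕28 · discharged 5∕27); one finite 𝕋⁴ at fixed ε — NOT infinite volume, NOT OS on ℝ⁴, NOT a mass gap, NOT Clay;
R4 closes the conditional finite-𝕋⁴ rung `BalabanLadder.UV` only.  Restate-immune (no Theses import).
-/

set_option autoImplicit false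

noncomputable section
open scoped BigOperators
open Finset

namespace Summit.QuantumFields.YangMills.BalabanUVNodes.N15.CurvedSpecies

open Literature.MathematicalPhysics.QuantumFieldTheory.Balaban1983to89
open Literature.MathematicalPhysics.QuantumFieldTheory.Balaban1983to89.B11SectG (BlockNorm HasMaj RowSum)
open Literature.MathematicalPhysics.QuantumFieldTheory.Balaban1983to89.B6RandomWalk (Triangle254)
open Literature.MathematicalPhysics.QuantumFieldTheory.Balaban1983to89.T4EtaRateDefect (idef idef_apply idef_comp idef_add idef_sub)
open Literature.MathematicalPhysics.QuantumFieldTheory.Balaban1983to89.T4EtaRateCoeffDefect (pull pull_apply diagK diagK_nonneg hasMaj_mulOp hasMaj_idef_mulOp)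
open Literature.MathematicalPhysics.QuantumFieldTheory.Balaban1983to89.B6Prop26Gluing (mulOp mulOp_apply ind ind_nonneg)
open Summit.QuantumFields.YangMills.BalabanUVNodes.N15.Gluing (parametrix remainder commOp glueInv lap_comp_cube sum_mulOp_sq hasMaj_parametrix hasMaj_idef_parametrix hasMaj_sum_overlap
  hasMaj_comp_diag hasMaj_diag_comp hasMaj_fsum hasMaj_remainder_in hasMaj_idef_remainder_in parametrix_cut glueInv_comp_lap lap_comp_glueInv isUnit_neumannR hasMaj_glueInv hasMaj_idef_glueInv)

/-! ## §1 The parametrix identity with per-cube locality defects -/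

section Identity

variable {X : Type} {ι : Type} [Fintype ι]

/-- one cube: `M_aΔG = M_a + E` ⟹ `Δ∘(M_aGM_a) = M_a² + EM_a + [Δ, M_a]GM_a`. [cite: Balaban1984PropagatorsII, (2.91)–(2.92) p.239 (mechanism)] -/
theorem lap_comp_cube_of_defect {Δ G E : (X → ℝ) →ₗ[ℝ] (X → ℝ)} {a : X → ℝ} (hloc : mulOp a ∘ₗ Δ ∘ₗ G = mulOp a + E) :
    Δ ∘ₗ (mulOp a ∘ₗ G ∘ₗ mulOp a) = mulOp a ∘ₗ mulOp a + E ∘ₗ mulOp a + commOp Δ a ∘ₗ G ∘ₗ mulOp a := by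
  have h1 : Δ ∘ₗ (mulOp a ∘ₗ G ∘ₗ mulOp a) = (mulOp a ∘ₗ Δ ∘ₗ G) ∘ₗ mulOp a + commOp Δ a ∘ₗ G ∘ₗ mulOp a := by
    simp only [commOp, LinearMap.sub_comp, LinearMap.comp_assoc]
    abel
  rw [h1, hloc, LinearMap.add_comp]

/-- ★ **THE PARAMETRIX IDENTITY WITH PER-CUBE LOCALITY DEFECTS**: `Σ_□h_□² = 1` and `M_{h_□}ΔG_□ = M_{h_□} + E_□` for every cube ⟹ `Δ∘G₀ = 1 − (R − Σ_□E_□M_{h_□})` with FILE 45's `G₀ = parametrix h G`,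
`R = remainder Δ h G` (dag-n15-c's `lap_comp_parametrix` is the case `E ≡ 0`). [cite: Balaban1984PropagatorsII, (2.36) p.229, (2.91)–(2.92) p.239 (mechanism); Balaban1984PropagatorsI, (1.120)–(1.123) p.37 (the nonlocal term in `R`: shape)] -/
theorem lap_comp_parametrix_of_defect {Δ : (X → ℝ) →ₗ[ℝ] (X → ℝ)} {h : ι → X → ℝ} {G E : ι → (X → ℝ) →ₗ[ℝ] (X → ℝ)} (h236 : ∀ x, ∑ i, h i x ^ 2 = 1)
    (hloc : ∀ i, mulOp (h i) ∘ₗ Δ ∘ₗ G i = mulOp (h i) + E i) :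
    Δ ∘ₗ parametrix h G = LinearMap.id - (remainder Δ h G - ∑ i, E i ∘ₗ mulOp (h i)) := by
  have hsum : Δ ∘ₗ parametrix h G = ∑ i, Δ ∘ₗ (mulOp (h i) ∘ₗ G i ∘ₗ mulOp (h i)) :=
    LinearMap.ext fun v => by simp only [parametrix, LinearMap.comp_apply, LinearMap.coe_sum, Finset.sum_apply, map_sum]
  have hterm : ∀ i, Δ ∘ₗ (mulOp (h i) ∘ₗ G i ∘ₗ mulOp (h i)) = mulOp (h i) ∘ₗ mulOp (h i) + E i ∘ₗ mulOp (h i) + commOp Δ (h i) ∘ₗ G i ∘ₗ mulOp (h i) :=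
    fun i => lap_comp_cube_of_defect (hloc i)
  rw [hsum, Finset.sum_congr rfl fun i _ => hterm i, Finset.sum_add_distrib, Finset.sum_add_distrib, sum_mulOp_sq h h236, remainder]
  abel

end Identity

/-! ## §2 Letters of the defect sum and of the full remainder -/

section Letters

variable {X X' : Type} [Fintype X] [Fintype X'] {ι : Type} [Fintype ι] {g : B6.Geometry} (blk : X → g.Site) (π : X' → X) (S : ι → Set g.Site) {σ cr : ℝ}

omit [Fintype X'] in
/-- ★★ **THE DEFECT SUM's LETTER**: per-cube OUTPUT-localized defect rows `E_□ ≤ 1_{S_□}(y)·εe^{−δd}`, `|h_□| ≤ 1`, bounded overlap `Σ_□1_{S_□} ≤ N_ov` ⟹ `Σ_□E_□M_{h_□} ≤ N_ov·ε·e^{−δd}`.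
[cite: Balaban1984PropagatorsII, (2.134)–(2.135) p.247 (bounded-overlap mechanism)] -/
theorem hasMaj_defectSum {h : ι → X → ℝ} {E : ι → (X → ℝ) →ₗ[ℝ] (X → ℝ)} {ε δ Nov : ℝ} (hε : 0 ≤ ε) (hh : ∀ i x, |h i x| ≤ 1) (hN : ∀ a, ∑ i, ind (S i) a ≤ Nov)
    (hE : ∀ i, HasMaj (BlockNorm.ofBlocks g blk) (BlockNorm.ofBlocks g blk) (E i) (fun y y' => ind (S i) y * (ε * Real.exp (-(δ * g.dist y y'))))) :
    HasMaj (BlockNorm.ofBlocks g blk) (BlockNorm.ofBlocks g blk) (∑ i, E i ∘ₗ mulOp (h i)) (fun y y' => Nov * (ε * Real.exp (-(δ * g.dist y y')))) := by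
  have hterm : ∀ i, HasMaj (BlockNorm.ofBlocks g blk) (BlockNorm.ofBlocks g blk) (E i ∘ₗ mulOp (h i)) (fun y y' => ind (S i) y * (ε * Real.exp (-(δ * g.dist y y')))) := fun i => by
    refine (hasMaj_comp_diag blk (m := fun _ => (1 : ℝ)) (fun y y' => mul_nonneg (ind_nonneg _ _) (mul_nonneg hε (Real.exp_nonneg _))) (hE i)
      (hasMaj_mulOp blk (fun _ => zero_le_one) (hh i))).mono fun y y' => le_of_eq ?_
    ring
  exact hasMaj_sum_overlap (b₁ := BlockNorm.ofBlocks g blk) (b₃ := BlockNorm.ofBlocks g blk) _ S _ Nov (fun y y' => mul_nonneg hε (Real.exp_nonneg _)) hterm hN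

omit [Fintype X'] in
/-- ★★ **THE FULL REMAINDER's LETTER**: input-localized commutator rows `[Δ, M_{h_□}]∘G_□ ≤ 1_{S_□}(y′)·θ₀e^{−δd}` (FILE 57) and output-localized defect rows `E_□ ≤ 1_{S_□}(y)·εe^{−δd}` ⟹
`R − Σ_□E_□M_{h_□} ≤ N_ov(θ₀ + ε)·e^{−δd}`. [cite: Balaban1984PropagatorsII, (2.135) p.247 (shape)] -/
theorem hasMaj_remainderD {Δ : (X → ℝ) →ₗ[ℝ] (X → ℝ)} {h : ι → X → ℝ} {G E : ι → (X → ℝ) →ₗ[ℝ] (X → ℝ)} {θ₀ ε δ Nov : ℝ} (hθ : 0 ≤ θ₀) (hε : 0 ≤ ε) (hh : ∀ i x, |h i x| ≤ 1)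
    (hN : ∀ a, ∑ i, ind (S i) a ≤ Nov)
    (hK : ∀ i, HasMaj (BlockNorm.ofBlocks g blk) (BlockNorm.ofBlocks g blk) (commOp Δ (h i) ∘ₗ G i) (fun y y' => ind (S i) y' * (θ₀ * Real.exp (-(δ * g.dist y y')))))
    (hE : ∀ i, HasMaj (BlockNorm.ofBlocks g blk) (BlockNorm.ofBlocks g blk) (E i) (fun y y' => ind (S i) y * (ε * Real.exp (-(δ * g.dist y y'))))) :
    HasMaj (BlockNorm.ofBlocks g blk) (BlockNorm.ofBlocks g blk) (remainder Δ h G - ∑ i, E i ∘ₗ mulOp (h i)) (fun y y' => Nov * (θ₀ + ε) * Real.exp (-(δ * g.dist y y'))) := by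
  refine ((hasMaj_remainder_in blk S hθ hh hN hK).sub (hasMaj_defectSum blk S hε hh hN hE)).mono fun y y' => le_of_eq ?_
  ring

/-- ★★ **THE DEFECT SUM's η-DEFECT**: `E′_□ ≤ 1_{S_□}(y)·εe^{−δd}` (fine), `𝔇(E′_□, E_□) ≤ 1_{S_□}(y)·r_Ee^{−δd}`, `|h_□| ≤ 1`, fit `|h′_□ − h_□∘π| ≤ o`, overlap ⟹ `𝔇(Σ_□E′_□M_{h′_□}, Σ_□E_□M_{h_□}) ≤ N_ov(εo + r_E)·e^{−δd}`.
[cite: Balaban1985BackgroundPropagators, Thm 3.14 pp.426–427 (difference template); Balaban1984PropagatorsII, (2.135) p.247] -/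
theorem hasMaj_idef_defectSum {h : ι → X → ℝ} {h' : ι → X' → ℝ} {E : ι → (X → ℝ) →ₗ[ℝ] (X → ℝ)} {E' : ι → (X' → ℝ) →ₗ[ℝ] (X' → ℝ)} {ε rE o δ Nov : ℝ} (hε : 0 ≤ ε) (hrE : 0 ≤ rE)
    (ho : 0 ≤ o) (hh : ∀ i x, |h i x| ≤ 1) (hfit : ∀ i x', |h' i x' - h i (π x')| ≤ o) (hN : ∀ a, ∑ i, ind (S i) a ≤ Nov)
    (hE' : ∀ i, HasMaj (BlockNorm.ofBlocks g (blk ∘ π)) (BlockNorm.ofBlocks g (blk ∘ π)) (E' i) (fun y y' => ind (S i) y * (ε * Real.exp (-(δ * g.dist y y')))))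
    (hDE : ∀ i, HasMaj (BlockNorm.ofBlocks g blk) (BlockNorm.ofBlocks g (blk ∘ π)) (idef (pull π) (pull π) (E' i) (E i)) (fun y y' => ind (S i) y * (rE * Real.exp (-(δ * g.dist y y'))))) :
    HasMaj (BlockNorm.ofBlocks g blk) (BlockNorm.ofBlocks g (blk ∘ π)) (idef (pull π) (pull π) (∑ i, E' i ∘ₗ mulOp (h' i)) (∑ i, E i ∘ₗ mulOp (h i)))
      (fun y y' => Nov * ((ε * o + rE) * Real.exp (-(δ * g.dist y y')))) := by
  have hsum : idef (pull π) (pull π) (∑ i, E' i ∘ₗ mulOp (h' i)) (∑ i, E i ∘ₗ mulOp (h i)) = ∑ i, idef (pull π) (pull π) (E' i ∘ₗ mulOp (h' i)) (E i ∘ₗ mulOp (h i)) := by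
    refine LinearMap.ext fun v => funext fun x' => ?_
    simp only [idef_apply, LinearMap.coe_sum, Finset.sum_apply, LinearMap.comp_apply, Pi.sub_apply, pull_apply, map_sum, Finset.sum_sub_distrib]
  have hterm : ∀ i, HasMaj (BlockNorm.ofBlocks g blk) (BlockNorm.ofBlocks g (blk ∘ π)) (idef (pull π) (pull π) (E' i ∘ₗ mulOp (h' i)) (E i ∘ₗ mulOp (h i)))
      (fun y y' => ind (S i) y * ((ε * o + rE) * Real.exp (-(δ * g.dist y y')))) := fun i => by
    rw [idef_comp (pull π) (pull π) (pull π) (E' i) (mulOp (h' i)) (E i) (mulOp (h i))]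
    have t1 := hasMaj_comp_diag (blk ∘ π) (m := fun _ => o) (fun y y' => mul_nonneg (ind_nonneg _ _) (mul_nonneg hε (Real.exp_nonneg _))) (hE' i)
      (hasMaj_idef_mulOp (g := g) blk π (o := fun _ => o) (fun _ => ho) (hfit i))
    have t2 := hasMaj_comp_diag blk (m := fun _ => (1 : ℝ)) (fun y y' => mul_nonneg (ind_nonneg _ _) (mul_nonneg hrE (Real.exp_nonneg _))) (hDE i)
      (hasMaj_mulOp blk (fun _ => zero_le_one) (hh i))
    refine (t1.add t2).mono fun y y' => le_of_eq ?_
    ring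
  rw [hsum]
  exact hasMaj_sum_overlap (b₁ := BlockNorm.ofBlocks g blk) (b₃ := BlockNorm.ofBlocks g (blk ∘ π)) _ S _ Nov (fun y y' => by positivity) hterm hN

/-- ★★ **THE FULL REMAINDER's η-DEFECT**: FILE 57 `hasMaj_idef_remainder_in` (`N_ov(θ₀o + r)`) plus ★★ above ⟹ `𝔇(R̃′, R̃) ≤ N_ov(θ₀o + r + εo + r_E)·e^{−δd}`. [cite: Balaban1985BackgroundPropagators, Thm 3.14 pp.426–427 (template)] -/
theorem hasMaj_idef_remainderD {Δ : (X → ℝ) →ₗ[ℝ] (X → ℝ)} {Δ' : (X' → ℝ) →ₗ[ℝ] (X' → ℝ)} {h : ι → X → ℝ} {h' : ι → X' → ℝ} {G E : ι → (X → ℝ) →ₗ[ℝ] (X → ℝ)}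
    {G' E' : ι → (X' → ℝ) →ₗ[ℝ] (X' → ℝ)} {θ₀ r ε rE o δ Nov : ℝ} (hθ : 0 ≤ θ₀) (hr : 0 ≤ r) (hε : 0 ≤ ε) (hrE : 0 ≤ rE) (ho : 0 ≤ o) (hh : ∀ i x, |h i x| ≤ 1)
    (hfit : ∀ i x', |h' i x' - h i (π x')| ≤ o) (hN : ∀ a, ∑ i, ind (S i) a ≤ Nov)
    (hK' : ∀ i, HasMaj (BlockNorm.ofBlocks g (blk ∘ π)) (BlockNorm.ofBlocks g (blk ∘ π)) (commOp Δ' (h' i) ∘ₗ G' i) (fun y y' => ind (S i) y' * (θ₀ * Real.exp (-(δ * g.dist y y')))))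
    (hDK : ∀ i, HasMaj (BlockNorm.ofBlocks g blk) (BlockNorm.ofBlocks g (blk ∘ π)) (idef (pull π) (pull π) (commOp Δ' (h' i) ∘ₗ G' i) (commOp Δ (h i) ∘ₗ G i))
      (fun y y' => ind (S i) y' * (r * Real.exp (-(δ * g.dist y y')))))
    (hE' : ∀ i, HasMaj (BlockNorm.ofBlocks g (blk ∘ π)) (BlockNorm.ofBlocks g (blk ∘ π)) (E' i) (fun y y' => ind (S i) y * (ε * Real.exp (-(δ * g.dist y y')))))
    (hDE : ∀ i, HasMaj (BlockNorm.ofBlocks g blk) (BlockNorm.ofBlocks g (blk ∘ π)) (idef (pull π) (pull π) (E' i) (E i)) (fun y y' => ind (S i) y * (rE * Real.exp (-(δ * g.dist y y'))))) :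
    HasMaj (BlockNorm.ofBlocks g blk) (BlockNorm.ofBlocks g (blk ∘ π))
      (idef (pull π) (pull π) (remainder Δ' h' G' - ∑ i, E' i ∘ₗ mulOp (h' i)) (remainder Δ h G - ∑ i, E i ∘ₗ mulOp (h i)))
      (fun y y' => Nov * (θ₀ * o + r + (ε * o + rE)) * Real.exp (-(δ * g.dist y y'))) := by
  rw [idef_sub]
  refine ((hasMaj_idef_remainder_in blk π S hθ hr ho hh hfit hN hK' hDK).sub (hasMaj_idef_defectSum blk π S hε hrE ho hh hfit hN hE' hDE)).mono fun y y' => le_of_eq ?_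
  ring

end Letters

/-! ## §3 The glued operator with defects: inverse by name, decay, η-defect -/

section Glued

variable {X X' : Type} [Fintype X] [Fintype X'] [DecidableEq X] [DecidableEq X'] {ι : Type} [Fintype ι] {g : B6.Geometry} (blk : X → g.Site) (π : X' → X)
  (S : ι → Set g.Site) {σ cr : ℝ}

omit [Fintype X'] [DecidableEq X'] in
/-- ★★★ **THE GLUED OPERATOR WITH DEFECTS IS A TWO-SIDED INVERSE**: `Σ_□h_□² = 1`, `M_{h_□}ΔG_□ = M_{h_□} + E_□`, the remainder-with-defects letter `R̃ ≤ θe^{−δd}` with `θc_r < 1` (`σ ≤ δ`) ⟹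
`glueInv G₀ R̃ ∘ Δ = 1` and `Δ ∘ glueInv G₀ R̃ = 1` (FILE 43 `glueInv_comp_lap` ∕ `lap_comp_glueInv` at the identity of §1). [cite: Balaban1984PropagatorsII, (2.91) p.239, (2.135)–(2.136) p.247 (mechanism)] -/
theorem glued_inverse_of_defect (hd : ∀ a b : g.Site, 0 ≤ g.dist a b) (hrow : RowSum g σ cr) {Δ : (X → ℝ) →ₗ[ℝ] (X → ℝ)} {h : ι → X → ℝ} {G E : ι → (X → ℝ) →ₗ[ℝ] (X → ℝ)}
    {θ δ : ℝ} (hθ : 0 ≤ θ) (hσδ : σ ≤ δ) (h236 : ∀ x, ∑ i, h i x ^ 2 = 1) (hloc : ∀ i, mulOp (h i) ∘ₗ Δ ∘ₗ G i = mulOp (h i) + E i)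
    (hR : HasMaj (BlockNorm.ofBlocks g blk) (BlockNorm.ofBlocks g blk) (remainder Δ h G - ∑ i, E i ∘ₗ mulOp (h i)) (fun y y' => θ * Real.exp (-(δ * g.dist y y')))) (hq : θ * cr < 1) :
    glueInv (parametrix h G) (remainder Δ h G - ∑ i, E i ∘ₗ mulOp (h i)) ∘ₗ Δ = LinearMap.id ∧
      Δ ∘ₗ glueInv (parametrix h G) (remainder Δ h G - ∑ i, E i ∘ₗ mulOp (h i)) = LinearMap.id := by
  have hunit := isUnit_neumannR blk hd hrow hθ hσδ hR hq
  have h291 := lap_comp_parametrix_of_defect h236 hloc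
  exact ⟨glueInv_comp_lap hunit h291, lap_comp_glueInv hunit h291⟩

omit [Fintype X'] [DecidableEq X'] in
/-- ★★★ **THE GLUED PROPAGATOR WITH DEFECTS DECAYS, from cut rows (one grid)** — FILE 63 `hasMaj_glued_of_cutRows` with the defect rows added: cut letters `M_{χ_□}G_□ ≤ 1_S1_S·βe^{−δd}`,
`M_{h_□}M_{χ_□} = M_{h_□}`, input-localized commutator rows `θ₀`, output-localized defect rows `ε`, overlap `N_ov`, `N_ov(θ₀ + ε)c_r < 1` ⟹
`glueInv G₀ R̃ ≤ N_ovβ(1 − N_ov(θ₀ + ε)c_r)⁻¹c_r·e^{−(δ−σ)d}`. [cite: Balaban1984PropagatorsII, (2.91) p.239, (2.133)–(2.136) p.247 (mechanism)] -/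
theorem hasMaj_glued_of_cutRows_defect (htri : Triangle254 g) (hd : ∀ a b : g.Site, 0 ≤ g.dist a b) (hd0 : ∀ y : g.Site, g.dist y y = 0) (hrow : RowSum g σ cr) (hσ : 0 ≤ σ)
    {Δ : (X → ℝ) →ₗ[ℝ] (X → ℝ)} {h χ : ι → X → ℝ} {G E : ι → (X → ℝ) →ₗ[ℝ] (X → ℝ)} {β θ₀ ε δ Nov : ℝ} (hβ : 0 ≤ β) (hθ : 0 ≤ θ₀) (hε : 0 ≤ ε) (hNov : 0 ≤ Nov)
    (hσδ : 2 * σ ≤ δ) (hcut : ∀ i, mulOp (h i) ∘ₗ mulOp (χ i) = mulOp (h i)) (hh : ∀ i x, |h i x| ≤ 1) (hN : ∀ a, ∑ i, ind (S i) a ≤ Nov)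
    (hGc : ∀ i, HasMaj (BlockNorm.ofBlocks g blk) (BlockNorm.ofBlocks g blk) (mulOp (χ i) ∘ₗ G i) (fun y y' => ind (S i) y * ind (S i) y' * (β * Real.exp (-(δ * g.dist y y')))))
    (hK : ∀ i, HasMaj (BlockNorm.ofBlocks g blk) (BlockNorm.ofBlocks g blk) (commOp Δ (h i) ∘ₗ G i) (fun y y' => ind (S i) y' * (θ₀ * Real.exp (-(δ * g.dist y y')))))
    (hE : ∀ i, HasMaj (BlockNorm.ofBlocks g blk) (BlockNorm.ofBlocks g blk) (E i) (fun y y' => ind (S i) y * (ε * Real.exp (-(δ * g.dist y y')))))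
    (hq : Nov * (θ₀ + ε) * cr < 1) :
    HasMaj (BlockNorm.ofBlocks g blk) (BlockNorm.ofBlocks g blk) (glueInv (parametrix h G) (remainder Δ h G - ∑ i, E i ∘ₗ mulOp (h i)))
      (fun y y' => Nov * β * (1 - Nov * (θ₀ + ε) * cr)⁻¹ * cr * Real.exp (-((δ - σ) * g.dist y y'))) := by
  have hP := hasMaj_parametrix blk S hβ hh hN hGc
  rw [parametrix_cut hcut] at hP
  exact hasMaj_glueInv blk htri hd hd0 hrow hσ (mul_nonneg hNov hβ) (mul_nonneg hNov (add_nonneg hθ hε)) hσδ hP (hasMaj_remainderD blk S hθ hε hh hN hK hE) hq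

/-- ★★★ **THE η-DEFECT OF THE GLUED PROPAGATOR WITH DEFECTS FROM CUT ROWS** — FILE 63 `hasMaj_idef_glued_of_cutRows` with the defect rows added (fine letters `ε`, defects `r_E`, both
OUTPUT-localized); constants: `θ ↦ N_ov(θ₀ + ε)`, `r ↦ N_ov(θ₀o + r + εo + r_E)`. [cite: Balaban1984PropagatorsII, (2.36)–(2.37) p.229, (2.91)–(2.92) p.239, (2.133)–(2.136) p.247 (mechanism); Balaban1985BackgroundPropagators, Thm 3.14 pp.426–427 (template)] -/
theorem hasMaj_idef_glued_of_cutRows_defect (htri : Triangle254 g) (hd : ∀ a b : g.Site, 0 ≤ g.dist a b) (hd0 : ∀ y : g.Site, g.dist y y = 0) (hrow : RowSum g σ cr) (hσ : 0 ≤ σ)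
    (hcr : 0 ≤ cr) {Δ : (X → ℝ) →ₗ[ℝ] (X → ℝ)} {Δ' : (X' → ℝ) →ₗ[ℝ] (X' → ℝ)} {h χ : ι → X → ℝ} {h' χ' : ι → X' → ℝ} {G E : ι → (X → ℝ) →ₗ[ℝ] (X → ℝ)}
    {G' E' : ι → (X' → ℝ) →ₗ[ℝ] (X' → ℝ)} {β θ₀ ε m r rE o δ Nov : ℝ} (hβ : 0 ≤ β) (hθ : 0 ≤ θ₀) (hε : 0 ≤ ε) (hm : 0 ≤ m) (hr : 0 ≤ r) (hrE : 0 ≤ rE) (ho : 0 ≤ o)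
    (hNov : 0 ≤ Nov) (hσδ : 2 * σ ≤ δ) (hcut : ∀ i, mulOp (h i) ∘ₗ mulOp (χ i) = mulOp (h i)) (hcut' : ∀ i, mulOp (h' i) ∘ₗ mulOp (χ' i) = mulOp (h' i))
    (hh : ∀ i x, |h i x| ≤ 1) (hh' : ∀ i x', |h' i x'| ≤ 1) (hfit : ∀ i x', |h' i x' - h i (π x')| ≤ o) (hN : ∀ b, ∑ i, ind (S i) b ≤ Nov)
    (hGc : ∀ i, HasMaj (BlockNorm.ofBlocks g blk) (BlockNorm.ofBlocks g blk) (mulOp (χ i) ∘ₗ G i) (fun y y' => ind (S i) y * ind (S i) y' * (β * Real.exp (-(δ * g.dist y y')))))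
    (hGc' : ∀ i, HasMaj (BlockNorm.ofBlocks g (blk ∘ π)) (BlockNorm.ofBlocks g (blk ∘ π)) (mulOp (χ' i) ∘ₗ G' i)
      (fun y y' => ind (S i) y * ind (S i) y' * (β * Real.exp (-(δ * g.dist y y')))))
    (hK : ∀ i, HasMaj (BlockNorm.ofBlocks g blk) (BlockNorm.ofBlocks g blk) (commOp Δ (h i) ∘ₗ G i) (fun y y' => ind (S i) y' * (θ₀ * Real.exp (-(δ * g.dist y y')))))
    (hK' : ∀ i, HasMaj (BlockNorm.ofBlocks g (blk ∘ π)) (BlockNorm.ofBlocks g (blk ∘ π)) (commOp Δ' (h' i) ∘ₗ G' i)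
      (fun y y' => ind (S i) y' * (θ₀ * Real.exp (-(δ * g.dist y y')))))
    (hE : ∀ i, HasMaj (BlockNorm.ofBlocks g blk) (BlockNorm.ofBlocks g blk) (E i) (fun y y' => ind (S i) y * (ε * Real.exp (-(δ * g.dist y y')))))
    (hE' : ∀ i, HasMaj (BlockNorm.ofBlocks g (blk ∘ π)) (BlockNorm.ofBlocks g (blk ∘ π)) (E' i) (fun y y' => ind (S i) y * (ε * Real.exp (-(δ * g.dist y y')))))
    (hDGc : ∀ i, HasMaj (BlockNorm.ofBlocks g blk) (BlockNorm.ofBlocks g (blk ∘ π)) (idef (pull π) (pull π) (mulOp (χ' i) ∘ₗ G' i) (mulOp (χ i) ∘ₗ G i))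
      (fun y y' => ind (S i) y * ind (S i) y' * (m * Real.exp (-(δ * g.dist y y')))))
    (hDK : ∀ i, HasMaj (BlockNorm.ofBlocks g blk) (BlockNorm.ofBlocks g (blk ∘ π)) (idef (pull π) (pull π) (commOp Δ' (h' i) ∘ₗ G' i) (commOp Δ (h i) ∘ₗ G i))
      (fun y y' => ind (S i) y' * (r * Real.exp (-(δ * g.dist y y')))))
    (hDE : ∀ i, HasMaj (BlockNorm.ofBlocks g blk) (BlockNorm.ofBlocks g (blk ∘ π)) (idef (pull π) (pull π) (E' i) (E i)) (fun y y' => ind (S i) y * (rE * Real.exp (-(δ * g.dist y y')))))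
    (hq : Nov * (θ₀ + ε) * cr < 1) :
    HasMaj (BlockNorm.ofBlocks g blk) (BlockNorm.ofBlocks g (blk ∘ π))
      (idef (pull π) (pull π) (glueInv (parametrix h' G') (remainder Δ' h' G' - ∑ i, E' i ∘ₗ mulOp (h' i)))
        (glueInv (parametrix h G) (remainder Δ h G - ∑ i, E i ∘ₗ mulOp (h i))))
      (fun y y' => (Nov * β * ((1 - Nov * (θ₀ + ε) * cr)⁻¹ * ((1 - Nov * (θ₀ + ε) * cr)⁻¹ * (Nov * (θ₀ * o + r + (ε * o + rE))) * cr) * cr) * cr +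
        Nov * (2 * β * o + m) * (1 - Nov * (θ₀ + ε) * cr)⁻¹ * cr) * Real.exp (-((δ - 2 * σ) * g.dist y y'))) := by
  have e0 := parametrix_cut (G := G) hcut
  have e0' := parametrix_cut (G := G') hcut'
  have hP' := hasMaj_parametrix (blk ∘ π) S hβ hh' hN hGc'
  have hIP := hasMaj_idef_parametrix blk π S hβ hm ho hh hh' hfit hN hGc hGc' hDGc
  rw [e0'] at hP'
  rw [e0, e0'] at hIP
  exact hasMaj_idef_glueInv blk π htri hd hd0 hrow hσ hcr (mul_nonneg hNov hβ) (mul_nonneg hNov (add_nonneg hθ hε)) (mul_nonneg hNov (by positivity)) (mul_nonneg hNov (by positivity))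
    hσδ hP' (hasMaj_remainderD blk S hθ hε hh hN hK hE) (hasMaj_remainderD (blk ∘ π) S hθ hε hh' hN hK' hE') hIP
    (hasMaj_idef_remainderD blk π S hθ hr hε hrE ho hh hfit hN hK' hDK hE' hDE) hq

end Glued

end Summit.QuantumFields.YangMills.BalabanUVNodes.N15.CurvedSpecies

end
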